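import Literature.Analysis.FluidPDE.CKNLocalRegularityRRSStep2
import Literature.Analysis.FluidPDE.CKNLocalRegularityRRSGlueLR
import Literature.Analysis.FluidPDE.CKNEpsilonRegularityViscosity
import HarnessLib

/-!
# Lemarié-Rieusset's Thm. 14.4 for solenoidal forces, from the local pressure estimate

Analysis/FluidPDE file in the decomposition of the named fact
`Literature.Analysis.FluidPDE.lemarieRieusset_epsilon_regularity` (Lemarié-Rieusset 2016,
Thm. 14.4, the Caffarelli–Kohn–Nirenberg ε-regularity criterion with a force `f ∈ L^q`,
`q > 5/2`). With Steps 1–4 of Robinson–Rodrigo–Sadowski's proof of their Theorem 15.3 and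
Lemma 15.11 now proved (`CKNLocalRegularityRRS*.lean`), the only unproved analytic input of the
induction is the local pressure estimate `RRS2016.lemma15_12` (RRS Lemma 15.12, a
Calderón–Zygmund estimate). This file records what that yields for Thm. 14.4:

* `lemarieRieusset_epsilon_regularity_divFree` — Thm. 14.4 **for solenoidal forces**
  (`div f = 0` in `𝒟'(Ω)`, the standing assumption of Caffarelli–Kohn–Nirenberg 1982, §1:
  "we assume `f` divergence-free; this involves no loss of generality, since the gradient part
  can be absorbed in the pressure"), at all viscosities, scales and centres (named statement, in
  the structured form `IsLRSuitableWeakSolutionOn` of the accepted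
  `lemarieRieusset_epsilon_regularity_iff`);
* `lemarieRieusset_epsilon_regularity_divFree_of_lemma15_12` — **proved**:
  `RRS2016.lemma15_12 → lemarieRieusset_epsilon_regularity_divFree`;
* `lemarieRieusset_epsilon_regularity_zeroForce_of_lemma15_12` — **proved**: the unforced case
  (`f = 0`) of the named fact `lemarieRieusset_epsilon_regularity` itself, from `lemma15_12`.

The reduction of the general (non-solenoidal) force to the solenoidal case (Helmholtz
decomposition of `f` in `L^q`, absorbing `∇π` into the pressure) is not carried out here.

## The proof

`RRS2016.theorem15_3_force_of_lemma15_12` (Theorem 15.3 with force) and the accepted glue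
`lemarieRieusset_unitScale_nu_one_divFree_of_theorem15_3_force` give the case `ν = 1`,
`r₀ = 1` (any centre). The Navier–Stokes scaling (`IsLRSuitableWeakSolutionOn.nsRescale`) and
the viscosity normalisation with the countable covering of the accepted
`lemarieRieusset_epsilon_regularity_of_nu_one` (`CKNEpsilonRegularityViscosity.lean`) are
repeated verbatim, the only new point being that the solenoidality of the force is covariant
under the affine space–time substitutions (`divFree_smul_stPull`).

## References

* P. G. Lemarié-Rieusset, *The Navier–Stokes Problem in the 21st Century*, CRC Press (2016),
  Thm. 14.4 p. 505. [LemarieRieusset2016]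
* J. C. Robinson, J. L. Rodrigo, W. Sadowski, *The Three-Dimensional Navier–Stokes Equations*,
  CUP (2016), Thm. 15.3 and Lemma 15.12. [RobinsonRodrigoSadowski2016]
* L. Caffarelli, R. Kohn, L. Nirenberg, *Partial regularity of suitable weak solutions of the
  Navier–Stokes equations*, CPAM 35 (1982), Proposition 1 and §1–§2. [CaffarelliKohnNirenberg1982]
-/

noncomputable section

open MeasureTheory Set Function Filter Topology TopologicalSpace Metric
open scoped NNReal ENNReal InnerProductSpace RealInnerProductSpace Laplacian

namespace Literature.Analysis.FluidPDE

/-! ### Statements -/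

/-- **Thm. 14.4 for solenoidal forces** (Lemarié-Rieusset 2016, Thm. 14.4, with the force
assumed divergence free as in Caffarelli–Kohn–Nirenberg 1982, Proposition 1): for `ν > 0`,
`q > 5/2` there are `ε₀, C₀ > 0` (depending only on `ν, q`) such that for every datum
`(Ω, f, u, p, G)` satisfying the §14.3 hypotheses (`IsLRSuitableWeakSolutionOn`) with
`div f = 0` in `𝒟'(Ω)`, every `Q_{r₀}(z₀) ⊆ Ω` and `0 ≤ λ ≤ ε₀`:
`∫∫_{Q_{r₀}} (|u|³ + |p|^{3/2}) ≤ λ³ r₀²` and `∫∫_{Q_{r₀}} |f|^q ≤ λ^{2q} r₀^{5-3q}` imply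
`|u| ≤ C₀ λ / r₀` a.e. on `Q_{r₀/2}(z₀)`. [cite: LemarieRieusset2016, Thm. 14.4 p. 505, solenoidal force] -/
def lemarieRieusset_epsilon_regularity_divFree : Prop :=
  ∀ (ν q : ℝ), 0 < ν → 5 / 2 < q → ∃ ε₀ C₀ : ℝ, 0 < ε₀ ∧ 0 < C₀ ∧
    ∀ (Ω : Opens (ℝ × EuclideanSpace ℝ (Fin 3)))
      (f u : ℝ → EuclideanSpace ℝ (Fin 3) → EuclideanSpace ℝ (Fin 3))
      (p : ℝ → EuclideanSpace ℝ (Fin 3) → ℝ)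
      (G : ℝ → EuclideanSpace ℝ (Fin 3) → EuclideanSpace ℝ (Fin 3) →L[ℝ] EuclideanSpace ℝ (Fin 3)),
      IsLRSuitableWeakSolutionOn Ω ν q f u p G →
      (∀ φ : ℝ → EuclideanSpace ℝ (Fin 3) → ℝ, IsSpaceTimeTestOn Ω φ →
        ∫ t, ∫ x, ⟪f t x, gradient (φ t) x⟫ = 0) →
      ∀ (z₀ : ℝ × EuclideanSpace ℝ (Fin 3)) (r₀ l : ℝ), 0 < r₀ →
        parabolicCylinder r₀ z₀ ⊆ (Ω : Set (ℝ × EuclideanSpace ℝ (Fin 3))) → 0 ≤ l → l ≤ ε₀ →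
        ∫⁻ w in parabolicCylinder r₀ z₀,
            (‖u w.1 w.2‖ₑ ^ (3 : ℕ) + ‖p w.1 w.2‖ₑ ^ (3 / 2 : ℝ)) ≤ ENNReal.ofReal (l ^ 3 * r₀ ^ 2) →
        ∫⁻ w in parabolicCylinder r₀ z₀, ‖f w.1 w.2‖ₑ ^ q ≤
          ENNReal.ofReal (l ^ (2 * q) * r₀ ^ (5 - 3 * q)) →
        ∀ᵐ w ∂(volume.restrict (parabolicCylinder (r₀ / 2) z₀)), ‖u w.1 w.2‖ ≤ C₀ * l / r₀

/-- **Thm. 14.4 for solenoidal forces, `ν = 1`, `r₀ = 1`** (any centre): the conclusion of the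
accepted `lemarieRieusset_unitScale_nu_one_divFree_of_theorem15_3_force`, as a named
statement. [cite: LemarieRieusset2016, Thm. 14.4 p. 505, case ν = 1, r₀ = 1, solenoidal force] -/
def lemarieRieusset_epsilon_regularity_nu_one_divFree : Prop :=
  ∀ q : ℝ, 5 / 2 < q → ∃ ε₀ C₀ : ℝ, 0 < ε₀ ∧ 0 < C₀ ∧
    ∀ (Ω : Opens (ℝ × EuclideanSpace ℝ (Fin 3)))
      (f u : ℝ → EuclideanSpace ℝ (Fin 3) → EuclideanSpace ℝ (Fin 3))
      (p : ℝ → EuclideanSpace ℝ (Fin 3) → ℝ)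
      (G : ℝ → EuclideanSpace ℝ (Fin 3) → EuclideanSpace ℝ (Fin 3) →L[ℝ] EuclideanSpace ℝ (Fin 3)),
      IsLRSuitableWeakSolutionOn Ω 1 q f u p G →
      (∀ φ : ℝ → EuclideanSpace ℝ (Fin 3) → ℝ, IsSpaceTimeTestOn Ω φ →
        ∫ t, ∫ x, ⟪f t x, gradient (φ t) x⟫ = 0) →
      ∀ (z₀ : ℝ × EuclideanSpace ℝ (Fin 3)) (l : ℝ),
        parabolicCylinder 1 z₀ ⊆ (Ω : Set (ℝ × EuclideanSpace ℝ (Fin 3))) → 0 ≤ l → l ≤ ε₀ →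
        ∫⁻ w in parabolicCylinder 1 z₀,
            (‖u w.1 w.2‖ₑ ^ (3 : ℕ) + ‖p w.1 w.2‖ₑ ^ (3 / 2 : ℝ)) ≤ ENNReal.ofReal (l ^ 3) →
        ∫⁻ w in parabolicCylinder 1 z₀, ‖f w.1 w.2‖ₑ ^ q ≤ ENNReal.ofReal (l ^ (2 * q)) →
        ∀ᵐ w ∂(volume.restrict (parabolicCylinder (1 / 2) z₀)), ‖u w.1 w.2‖ ≤ C₀ * l

/-! ### The case `ν = 1`, `r₀ = 1` from the local pressure estimate -/

/-- `RRS2016.lemma15_12 → (Thm. 14.4, solenoidal force, ν = 1, r₀ = 1)`: Theorem 15.3 with force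
from the local pressure estimate (`RRS2016.theorem15_3_force_of_lemma15_12`), glued to the §14.3
hypotheses (`lemarieRieusset_unitScale_nu_one_divFree_of_theorem15_3_force`). [cite: LemarieRieusset2016, Thm. 14.4 p. 505] -/
theorem lemarieRieusset_epsilon_regularity_nu_one_divFree_of_lemma15_12 (h12 : RRS2016.lemma15_12) :
    lemarieRieusset_epsilon_regularity_nu_one_divFree := fun _ hq =>
  lemarieRieusset_unitScale_nu_one_divFree_of_theorem15_3_force
    (RRS2016.theorem15_3_force_of_lemma15_12 h12) hq

/-! ### Covariance of the solenoidality of the force -/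

section DivFree

variable {E : Type*} [NormedAddCommGroup E] [InnerProductSpace ℝ E] [FiniteDimensional ℝ E]
  [MeasurableSpace E] [BorelSpace E]

/-- **Solenoidal forces stay solenoidal under the affine space–time substitutions**: if
`∫ dt ∫ dx ⟪f, ∇φ⟫ = 0` for all `φ ∈ C_c^∞(Q)`, then the same holds for `c · f ∘ Φ` against
`C_c^∞(Φ⁻¹(Q))`, `Φ(s, y) = (t₀ + β s, x₀ + γ y)`, `β, γ > 0` (chain rule `∇(φ ∘ Φ⁻¹)` and the
iterated change of variables `ds dy = (β γⁿ)⁻¹ dt dx`). [folklore] -/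
theorem divFree_smul_stPull {Q : Opens (ℝ × E)} {f : ℝ → E → E}
    (hdiv : ∀ φ : ℝ → E → ℝ, IsSpaceTimeTestOn Q φ → ∫ t, ∫ x, ⟪f t x, gradient (φ t) x⟫ = 0)
    (c : ℝ) {β γ : ℝ} (hβ : 0 < β) (hγ : 0 < γ) (t₀ : ℝ) (x₀ : E) :
    ∀ φ : ℝ → E → ℝ, IsSpaceTimeTestOn (stPreimage β γ t₀ x₀ Q) φ →
      ∫ s, ∫ y, ⟪(c • stPull β γ t₀ x₀ f) s y, gradient (φ s) y⟫ = 0 := by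
  intro φ hφ
  set φ' := stPull β⁻¹ γ⁻¹ (-(β⁻¹ * t₀)) (-(γ⁻¹ • x₀)) φ with hφ'
  have hφ'Q : IsSpaceTimeTestOn Q φ' := hφ.stPull_symm hβ.ne' hγ.ne'
  have hrepr : φ = stPull β γ t₀ x₀ φ' := (stPull_stPull_symm hβ.ne' hγ.ne' t₀ x₀ φ).symm
  set F : ℝ → E → ℝ := fun t x => ⟪f t x, gradient (φ' t) x⟫ with hF
  have hzero : ∫ t, ∫ x, F t x = 0 := hdiv φ' hφ'Q
  have key : ∀ (s : ℝ) (y : E), ⟪(c • stPull β γ t₀ x₀ f) s y, gradient (φ s) y⟫ =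
      (c * γ) * F (t₀ + β * s) (x₀ + γ • y) := by
    intro s y
    conv_lhs => rw [hrepr]
    rw [gradient_stPull, smul_stPull_apply, real_inner_smul_left, real_inner_smul_right, hF]
    ring
  simp_rw [key, integral_const_mul]
  rw [integral_integral_comp_stAffine hβ hγ t₀ x₀ F, hzero, smul_zero, mul_zero]

end DivFree

/-- Local notation for physical space `ℝ³ = EuclideanSpace ℝ (Fin 3)`. -/
local notation "ℝ³" => EuclideanSpace ℝ (Fin 3)

/-- `(r²)^{3/2} = r³` for `r ≥ 0`. [folklore] -/
private theorem sq_rpow_three_halves_df {r : ℝ} (hr : 0 ≤ r) : (r ^ 2) ^ (3 / 2 : ℝ) = r ^ 3 := by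
  rw [← Real.rpow_natCast r 2, ← Real.rpow_mul hr, ← Real.rpow_natCast r 3]
  norm_num

/-! ### Reduction to unit viscosity (solenoidal forces) -/

set_option maxHeartbeats 800000 in
/-- **Solenoidal Thm. 14.4 at unit scale follows from its case `ν = 1`**: the proof of the
accepted `lemarieRieusset_epsilon_regularity_of_nu_one` verbatim (viscosity normalisation
`u ↦ (c/ν) u(c² s/ν, c y)`, `c = min(1, ν^{1/2})`, and a countable covering), with the
solenoidality of the force transported by `divFree_smul_stPull`. Conclusion: the unit-scale
(`r₀ = 1`, centre `0`) solenoidal statement at viscosity `ν`. [cite: LemarieRieusset2016, Thm. 14.4 p. 505] -/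
theorem lemarieRieusset_epsilon_regularity_unitScale_divFree_of_nu_one_divFree
    (h : lemarieRieusset_epsilon_regularity_nu_one_divFree) {ν q : ℝ} (hν : 0 < ν) (hq : 5 / 2 < q) :
    ∃ ε₀ C₀ : ℝ, 0 < ε₀ ∧ 0 < C₀ ∧
      ∀ (Ω : Opens (ℝ × ℝ³)) (f u : ℝ → ℝ³ → ℝ³) (p : ℝ → ℝ³ → ℝ) (G : ℝ → ℝ³ → ℝ³ →L[ℝ] ℝ³),
        IsLRSuitableWeakSolutionOn Ω ν q f u p G →
        (∀ φ : ℝ → ℝ³ → ℝ, IsSpaceTimeTestOn Ω φ → ∫ t, ∫ x, ⟪f t x, gradient (φ t) x⟫ = 0) →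
        ∀ l : ℝ, parabolicCylinder 1 (0 : ℝ × ℝ³) ⊆ (Ω : Set (ℝ × ℝ³)) → 0 ≤ l → l ≤ ε₀ →
          ∫⁻ w in parabolicCylinder 1 (0 : ℝ × ℝ³),
              (‖u w.1 w.2‖ₑ ^ (3 : ℕ) + ‖p w.1 w.2‖ₑ ^ (3 / 2 : ℝ)) ≤ ENNReal.ofReal (l ^ 3) →
          ∫⁻ w in parabolicCylinder 1 (0 : ℝ × ℝ³), ‖f w.1 w.2‖ₑ ^ q ≤ ENNReal.ofReal (l ^ (2 * q)) →
          ∀ᵐ w ∂(volume.restrict (parabolicCylinder (1 / 2) (0 : ℝ × ℝ³))), ‖u w.1 w.2‖ ≤ C₀ * l := by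
  obtain ⟨ε₁, C₁, hε₁, hC₁, H⟩ := h q hq
  have hq0 : 0 < q := by linarith
  -- the scaling parameters
  set c : ℝ := min 1 (Real.sqrt ν) with hc
  have hc0 : 0 < c := lt_min one_pos (Real.sqrt_pos.2 hν)
  have hc1 : c ≤ 1 := min_le_left _ _
  have hc2 : c ^ 2 ≤ ν := by
    have h1 : c ≤ Real.sqrt ν := min_le_right _ _
    calc c ^ 2 ≤ (Real.sqrt ν) ^ 2 := pow_le_pow_left₀ hc0.le h1 2
      _ = ν := Real.sq_sqrt hν.le
  set α : ℝ := c / ν with hα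
  set β : ℝ := α * c with hβ
  have hα0 : 0 < α := by positivity
  have hγ0 : 0 < c := hc0
  have hβ0 : 0 < β := by positivity
  have hβ1 : β ≤ 1 := by
    rw [hβ, hα, div_mul_eq_mul_div, div_le_one hν]; nlinarith
  -- the constants
  set J : ℝ := β * c ^ 3 with hJ
  have hJ0 : 0 < J := by positivity
  set K₁ : ℝ := (α ^ 3 / J) ^ (1 / 3 : ℝ) with hK₁
  set K₂ : ℝ := ((α ^ 2 * c) ^ q / J) ^ (1 / (2 * q)) with hK₂
  set K : ℝ := max K₁ K₂ with hK
  have hK₁0 : 0 < K₁ := Real.rpow_pos_of_pos (by positivity) _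
  have hK0 : 0 < K := lt_max_of_lt_left hK₁0
  have hK3 : α ^ 3 / J ≤ K ^ 3 := by
    have : K₁ ^ 3 = α ^ 3 / J := by
      rw [hK₁, ← Real.rpow_natCast, ← Real.rpow_mul (by positivity)]; norm_num
    rw [← this]
    exact pow_le_pow_left₀ hK₁0.le (le_max_left _ _) 3
  have hK2q : (α ^ 2 * c) ^ q / J ≤ K ^ (2 * q) := by
    have hK₂0 : 0 ≤ K₂ := Real.rpow_nonneg (by positivity) _
    have : K₂ ^ (2 * q) = (α ^ 2 * c) ^ q / J := by
      rw [hK₂, ← Real.rpow_mul (by positivity), one_div_mul_cancel (by positivity),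
        Real.rpow_one]
    rw [← this]
    exact Real.rpow_le_rpow hK₂0 (le_max_right _ _) (by positivity)
  refine ⟨ε₁ / K, C₁ * K / α, div_pos hε₁ hK0, by positivity, ?_⟩
  intro Ω f u p G hS hdivf l hsub hl hlε hUP hF
  -- the rescaled datum, of viscosity `1`
  have hS' := hS.stRescale hα0 hγ0 hβ.symm.symm 0 0
  have e1 : α * ν / c = 1 := by rw [hα]; field_simp
  rw [e1] at hS'
  have hdivf' := divFree_smul_stPull hdivf (α ^ 2 * c) hβ0 hγ0 0 (0 : ℝ³)
  set Φ := stAffine β c 0 (0 : ℝ³) with hΦ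
  -- the slab `Φ⁻¹(Q_1(0))`
  have hslab : Φ ⁻¹' parabolicCylinder 1 (0 : ℝ × ℝ³) = Ioo (-1 / β) 0 ×ˢ ball (0 : ℝ³) (1 / c) := by
    rw [parabolicCylinder, hΦ, stAffine_preimage_cylinder hβ0 hγ0]
    simp only [Prod.fst_zero, Prod.snd_zero, one_pow, zero_sub, sub_zero, zero_div, smul_zero]
  have htarget : Φ ⁻¹' parabolicCylinder (1 / 2) (0 : ℝ × ℝ³) =
      Ioo (-(1 / 2) ^ 2 / β) 0 ×ˢ ball (0 : ℝ³) (1 / 2 / c) := by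
    rw [parabolicCylinder, hΦ, stAffine_preimage_cylinder hβ0 hγ0]
    simp only [Prod.fst_zero, Prod.snd_zero, zero_sub, sub_zero, zero_div, smul_zero]
  -- Jacobian
  have hJac : ENNReal.ofReal (β * c ^ Module.finrank ℝ ℝ³)⁻¹ = ENNReal.ofReal J⁻¹ := by
    rw [finrank_euclideanSpace_three]
  -- smallness on the slab
  set u' := α • stPull β c 0 (0 : ℝ³) u with hu'
  set p' := α ^ 2 • stPull β c 0 (0 : ℝ³) p with hp'
  set f' := (α ^ 2 * c) • stPull β c 0 (0 : ℝ³) f with hf'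
  have hUP' : ∫⁻ w in Φ ⁻¹' parabolicCylinder 1 (0 : ℝ × ℝ³),
      (‖u' w.1 w.2‖ₑ ^ (3 : ℕ) + ‖p' w.1 w.2‖ₑ ^ (3 / 2 : ℝ)) ≤ ENNReal.ofReal ((K * l) ^ 3) := by
    set Fs : ℝ × ℝ³ → ℝ≥0∞ := fun z => ‖u z.1 z.2‖ₑ ^ (3 : ℕ) + ‖p z.1 z.2‖ₑ ^ (3 / 2 : ℝ) with hFs
    have hpt : ∀ w : ℝ × ℝ³,
        ‖u' w.1 w.2‖ₑ ^ (3 : ℕ) + ‖p' w.1 w.2‖ₑ ^ (3 / 2 : ℝ) = ENNReal.ofReal (α ^ 3) * Fs (Φ w) := by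
      intro w
      rw [hu', hp', smul_stPull_apply, smul_stPull_apply, enorm_smul, enorm_smul, mul_pow,
        ENNReal.mul_rpow_of_nonneg _ _ (by norm_num), Real.enorm_eq_ofReal hα0.le,
        Real.enorm_eq_ofReal (by positivity : (0:ℝ) ≤ α ^ 2), ← ENNReal.ofReal_pow hα0.le,
        ENNReal.ofReal_rpow_of_nonneg (by positivity) (by norm_num), sq_rpow_three_halves_df hα0.le,
        hFs, mul_add]
      rfl
    simp_rw [hpt]
    rw [lintegral_const_mul' _ _ ENNReal.ofReal_ne_top, hΦ,
      setLIntegral_preimage_comp_stAffine hβ0 hγ0 0 0 Fs, hJac]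
    calc ENNReal.ofReal (α ^ 3) * (ENNReal.ofReal J⁻¹ *
          ∫⁻ z in parabolicCylinder 1 (0 : ℝ × ℝ³), Fs z)
        ≤ ENNReal.ofReal (α ^ 3) * (ENNReal.ofReal J⁻¹ * ENNReal.ofReal (l ^ 3)) := by gcongr
      _ = ENNReal.ofReal (α ^ 3 / J * l ^ 3) := by
          rw [← ENNReal.ofReal_mul (by positivity), ← ENNReal.ofReal_mul (by positivity)]
          exact congrArg ENNReal.ofReal (by rw [div_eq_mul_inv, mul_assoc])
      _ ≤ ENNReal.ofReal ((K * l) ^ 3) := by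
          refine ENNReal.ofReal_le_ofReal ?_
          rw [mul_pow]
          exact mul_le_mul_of_nonneg_right hK3 (pow_nonneg hl 3)
  have hF' : ∫⁻ w in Φ ⁻¹' parabolicCylinder 1 (0 : ℝ × ℝ³),
      ‖f' w.1 w.2‖ₑ ^ q ≤ ENNReal.ofReal ((K * l) ^ (2 * q)) := by
    rw [hf', hΦ, setLIntegral_enorm_rpow_stRescale hβ0 hγ0 0 0 (α ^ 2 * c) f _ hq0.le, hJac,
      Real.enorm_eq_ofReal (by positivity), ENNReal.ofReal_rpow_of_nonneg (by positivity) hq0.le]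
    calc ENNReal.ofReal ((α ^ 2 * c) ^ q) * ENNReal.ofReal J⁻¹ *
          ∫⁻ z in parabolicCylinder 1 (0 : ℝ × ℝ³), ‖f z.1 z.2‖ₑ ^ q
        ≤ ENNReal.ofReal ((α ^ 2 * c) ^ q) * ENNReal.ofReal J⁻¹ * ENNReal.ofReal (l ^ (2 * q)) := by
          gcongr
      _ = ENNReal.ofReal ((α ^ 2 * c) ^ q / J * l ^ (2 * q)) := by
          rw [← ENNReal.ofReal_mul (by positivity), ← ENNReal.ofReal_mul (by positivity),
            div_eq_mul_inv]
      _ ≤ ENNReal.ofReal ((K * l) ^ (2 * q)) := by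
          refine ENNReal.ofReal_le_ofReal ?_
          rw [Real.mul_rpow hK0.le hl]
          exact mul_le_mul_of_nonneg_right hK2q (Real.rpow_nonneg hl _)
  -- the bound on every admissible unit cylinder of the slab
  have hl' : 0 ≤ K * l := by positivity
  have hl'ε : K * l ≤ ε₁ := by
    rw [le_div_iff₀ hK0] at hlε; linarith
  have hpiece : ∀ z' : ℝ × ℝ³, parabolicCylinder 1 z' ⊆ Φ ⁻¹' parabolicCylinder 1 (0 : ℝ × ℝ³) →
      ∀ᵐ w ∂(volume.restrict (parabolicCylinder (1 / 2) z')), ‖u (Φ w).1 (Φ w).2‖ ≤ C₁ * K / α * l := by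
    intro z' hz'
    have hsub' : parabolicCylinder 1 z' ⊆ ((stPreimage β c 0 (0 : ℝ³) Ω : Opens _) : Set _) := by
      rw [coe_stPreimage]
      exact hz'.trans (preimage_mono hsub)
    have h1 := H _ _ _ _ _ hS' hdivf' z' (K * l) hsub' hl' hl'ε
      ((lintegral_mono_set hz').trans hUP') ((lintegral_mono_set hz').trans hF')
    filter_upwards [h1] with w hw
    have e : ‖u' w.1 w.2‖ = α * ‖u (Φ w).1 (Φ w).2‖ := by
      rw [hu', smul_stPull_apply, norm_smul, Real.norm_eq_abs, abs_of_pos hα0]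
      rfl
    rw [e] at hw
    rw [div_mul_eq_mul_div, le_div_iff₀ hα0]
    linarith
  -- the countable covering of the target
  classical
  obtain ⟨D₀, hD₀c, hD₀d⟩ := TopologicalSpace.exists_countable_dense ℝ³
  set D : Set ℝ³ := insert 0 D₀ with hD
  have hDc : D.Countable := hD₀c.insert 0
  haveI : Countable D := hDc.to_subtype
  set piece : ℚ × D → Set (ℝ × ℝ³) := fun i =>
    if parabolicCylinder 1 ((i.1 : ℝ), (i.2 : ℝ³)) ⊆ Φ ⁻¹' parabolicCylinder 1 (0 : ℝ × ℝ³)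
    then parabolicCylinder (1 / 2) ((i.1 : ℝ), (i.2 : ℝ³)) else ∅
    with hpiece_def
  have hcover : Φ ⁻¹' parabolicCylinder (1 / 2) (0 : ℝ × ℝ³) ⊆ ⋃ i, piece i := by
    rintro ⟨s, y⟩ hw
    rw [htarget, mem_prod, mem_Ioo, mem_ball, dist_zero_right] at hw
    obtain ⟨⟨hs1, hs2⟩, hy⟩ := hw
    dsimp only at hs1 hs2 hy
    have hβinv : 1 ≤ 1 / β := by rw [le_div_iff₀ hβ0]; linarith
    obtain ⟨s', hs'Q, hs'1, hs'2, hs'3⟩ : ∃ s' : ℚ, True ∧ 1 - 1 / β ≤ (s' : ℝ) ∧ (s' : ℝ) ≤ 0 ∧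
        s ∈ Ioo ((s' : ℝ) - (1 / 2) ^ 2) (s' : ℝ) := by
      by_cases hs : -(1 / 2) ^ 2 < s
      · exact ⟨0, trivial, by push_cast; linarith, by push_cast; exact le_rfl,
          by push_cast; exact ⟨by linarith, hs2⟩⟩
      · have hs' : s ≤ -(1 / 2) ^ 2 := not_lt.1 hs
        have hlo : max s (1 - 1 / β) < s + (1 / 2) ^ 2 := by
          refine max_lt (by norm_num) ?_
          have h1 : -(1 / 2) ^ 2 / β < s := hs1
          rw [div_lt_iff₀ hβ0] at h1
          have h2 : (3 / 4 - s) * β < 1 := by nlinarith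
          have h3 : 3 / 4 - s < 1 / β := by rwa [lt_div_iff₀ hβ0]
          linarith
        obtain ⟨s', h1, h2⟩ := exists_rat_btwn hlo
        refine ⟨s', trivial, ((le_max_right _ _).trans_lt h1).le, ?_, ?_⟩
        · linarith
        · exact ⟨by linarith, (le_max_left _ _).trans_lt h1⟩
    have hy' : ‖y‖ < 1 / (2 * c) := by rw [← div_div]; exact hy
    obtain ⟨a, haD, ha1, ha2⟩ := exists_center_of_norm_lt hc0 hc1 hD₀d hy'
    have haD' : a ∈ D := by
      rcases haD with h | h
      · exact mem_insert_of_mem _ h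
      · rw [h]; exact mem_insert _ _
    refine mem_iUnion.2 ⟨(s', ⟨a, haD'⟩), ?_⟩
    have hadm : parabolicCylinder 1 ((s' : ℝ), a) ⊆ Φ ⁻¹' parabolicCylinder 1 (0 : ℝ × ℝ³) := by
      rw [hslab]
      rintro ⟨t, x⟩ htx
      rw [mem_parabolicCylinder] at htx
      obtain ⟨⟨ht1, ht2⟩, hx⟩ := htx
      refine ⟨⟨?_, by linarith⟩, ?_⟩
      · have : -1 / β = -(1 / β) := by ring
        rw [this]; linarith
      · rw [mem_ball, dist_zero_right]
        calc ‖x‖ = dist x 0 := (dist_zero_right x).symm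
          _ ≤ dist x a + dist a 0 := dist_triangle _ _ _
          _ < 1 + ‖a‖ := by rw [dist_zero_right]; linarith
          _ ≤ 1 / c := by linarith
    have hpi : piece (s', ⟨a, haD'⟩) = parabolicCylinder (1 / 2) ((s' : ℝ), a) := by
      simp only [hpiece_def]; exact if_pos hadm
    rw [hpi, mem_parabolicCylinder]
    exact ⟨hs'3, by rw [dist_eq_norm]; exact ha2⟩
  have hall : ∀ᵐ w ∂(volume.restrict (⋃ i, piece i)), ‖u (Φ w).1 (Φ w).2‖ ≤ C₁ * K / α * l := by
    rw [ae_restrict_iUnion_iff]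
    intro i
    by_cases hadm : parabolicCylinder 1 ((i.1 : ℝ), (i.2 : ℝ³)) ⊆ Φ ⁻¹' parabolicCylinder 1 (0 : ℝ × ℝ³)
    · have hpi : piece i = parabolicCylinder (1 / 2) ((i.1 : ℝ), (i.2 : ℝ³)) := by
        simp only [hpiece_def]; exact if_pos hadm
      rw [hpi]
      exact hpiece _ hadm
    · have hpi : piece i = ∅ := by simp only [hpiece_def]; exact if_neg hadm
      rw [hpi, Measure.restrict_empty, ae_zero]
      exact eventually_bot
  have htar : ∀ᵐ w ∂(volume.restrict (Φ ⁻¹' parabolicCylinder (1 / 2) (0 : ℝ × ℝ³))),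
      ‖u (Φ w).1 (Φ w).2‖ ≤ C₁ * K / α * l :=
    ae_restrict_of_ae_restrict_of_subset hcover hall
  exact ae_restrict_of_ae_restrict_preimage_stAffine hβ0 hγ0 0 (0 : ℝ³)
    (S := parabolicCylinder (1 / 2) (0 : ℝ × ℝ³)) (P := fun z => ‖u z.1 z.2‖ ≤ C₁ * K / α * l) htar

/-! ### Reduction to the unit cylinder (solenoidal forces) and assembly -/

/-- **Solenoidal Thm. 14.4 from its unit-scale case** (Navier–Stokes scaling, as in the accepted
`lemarieRieusset_epsilon_regularity_iff_unitScale`, with the solenoidality of the force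
transported by `divFree_smul_stPull`), hence **from `RRS2016.lemma15_12`**. [cite: LemarieRieusset2016, Thm. 14.4 p. 505] -/
theorem lemarieRieusset_epsilon_regularity_divFree_of_lemma15_12 (h12 : RRS2016.lemma15_12) :
    lemarieRieusset_epsilon_regularity_divFree := by
  intro ν q hν hq
  obtain ⟨ε₀, C₀, hε₀, hC₀, H⟩ :=
    lemarieRieusset_epsilon_regularity_unitScale_divFree_of_nu_one_divFree
      (lemarieRieusset_epsilon_regularity_nu_one_divFree_of_lemma15_12 h12) hν hq
  refine ⟨ε₀, C₀, hε₀, hC₀, fun Q f u p G hS hdivf z₀ r₀ l hr₀ hsub hl hlε hUP hF => ?_⟩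
  have hq0 : 0 < q := by linarith
  have hβ0 : (0 : ℝ) < r₀ ^ 2 := by positivity
  -- the rescaled datum
  have hS' := hS.nsRescale hr₀ z₀.1 z₀.2
  have hdivf' := divFree_smul_stPull hdivf (r₀ ^ 2 * r₀) hβ0 hr₀ z₀.1 z₀.2
  set Φ := stAffine (r₀ ^ 2) r₀ z₀.1 z₀.2 with hΦ
  have hpre : ∀ ρ : ℝ, Φ ⁻¹' parabolicCylinder ρ z₀ = parabolicCylinder (ρ / r₀) (0 : ℝ × ℝ³) :=
    fun ρ => stAffine_sq_preimage_parabolicCylinder hr₀ z₀ ρ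
  have hpre1 : Φ ⁻¹' parabolicCylinder r₀ z₀ = parabolicCylinder 1 (0 : ℝ × ℝ³) := by
    rw [hpre, div_self hr₀.ne']
  have hpre2 : Φ ⁻¹' parabolicCylinder (r₀ / 2) z₀ = parabolicCylinder (1 / 2) (0 : ℝ × ℝ³) := by
    rw [hpre]
    congr 1
    field_simp
  have h1 : parabolicCylinder 1 (0 : ℝ × ℝ³) ⊆
      ((stPreimage (r₀ ^ 2) r₀ z₀.1 z₀.2 Q : Opens (ℝ × ℝ³)) : Set (ℝ × ℝ³)) := by
    rw [coe_stPreimage, ← hpre1]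
    exact preimage_mono hsub
  have hJ : ENNReal.ofReal (r₀ ^ 2 * r₀ ^ Module.finrank ℝ ℝ³)⁻¹ = ENNReal.ofReal (r₀ ^ 5)⁻¹ := by
    rw [finrank_euclideanSpace_three]
    congr 1
    ring
  have h2 : ∫⁻ w in parabolicCylinder 1 (0 : ℝ × ℝ³),
      (‖(r₀ • stPull (r₀ ^ 2) r₀ z₀.1 z₀.2 u) w.1 w.2‖ₑ ^ (3 : ℕ) +
        ‖(r₀ ^ 2 • stPull (r₀ ^ 2) r₀ z₀.1 z₀.2 p) w.1 w.2‖ₑ ^ (3 / 2 : ℝ)) ≤ ENNReal.ofReal (l ^ 3) := by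
    set Fs : ℝ × ℝ³ → ℝ≥0∞ := fun z => ‖u z.1 z.2‖ₑ ^ (3 : ℕ) + ‖p z.1 z.2‖ₑ ^ (3 / 2 : ℝ) with hFs
    have hpt : ∀ w : ℝ × ℝ³,
        ‖(r₀ • stPull (r₀ ^ 2) r₀ z₀.1 z₀.2 u) w.1 w.2‖ₑ ^ (3 : ℕ) +
          ‖(r₀ ^ 2 • stPull (r₀ ^ 2) r₀ z₀.1 z₀.2 p) w.1 w.2‖ₑ ^ (3 / 2 : ℝ) =
        ENNReal.ofReal (r₀ ^ 3) * Fs (Φ w) := by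
      intro w
      rw [smul_stPull_apply, smul_stPull_apply, enorm_smul, enorm_smul, mul_pow,
        ENNReal.mul_rpow_of_nonneg _ _ (by norm_num), Real.enorm_eq_ofReal hr₀.le,
        Real.enorm_eq_ofReal hβ0.le, ← ENNReal.ofReal_pow hr₀.le,
        ENNReal.ofReal_rpow_of_nonneg hβ0.le (by norm_num), sq_rpow_three_halves_df hr₀.le, hFs, mul_add]
      rfl
    simp_rw [hpt]
    rw [lintegral_const_mul' _ _ ENNReal.ofReal_ne_top, ← hpre1,
      setLIntegral_preimage_comp_stAffine hβ0 hr₀ z₀.1 z₀.2 Fs, hJ]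
    calc ENNReal.ofReal (r₀ ^ 3) * (ENNReal.ofReal (r₀ ^ 5)⁻¹ * ∫⁻ z in parabolicCylinder r₀ z₀, Fs z)
        ≤ ENNReal.ofReal (r₀ ^ 3) * (ENNReal.ofReal (r₀ ^ 5)⁻¹ * ENNReal.ofReal (l ^ 3 * r₀ ^ 2)) := by
          gcongr
      _ = ENNReal.ofReal (l ^ 3) := by
          rw [← ENNReal.ofReal_mul (by positivity), ← ENNReal.ofReal_mul (by positivity)]
          congr 1
          field_simp
  have h3 : ∫⁻ w in parabolicCylinder 1 (0 : ℝ × ℝ³),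
      ‖((r₀ ^ 2 * r₀) • stPull (r₀ ^ 2) r₀ z₀.1 z₀.2 f) w.1 w.2‖ₑ ^ q ≤ ENNReal.ofReal (l ^ (2 * q)) := by
    rw [← hpre1, setLIntegral_enorm_rpow_stRescale hβ0 hr₀ z₀.1 z₀.2 (r₀ ^ 2 * r₀) f _ hq0.le, hJ,
      Real.enorm_eq_ofReal (by positivity), ENNReal.ofReal_rpow_of_nonneg (by positivity) hq0.le]
    calc ENNReal.ofReal ((r₀ ^ 2 * r₀) ^ q) * ENNReal.ofReal (r₀ ^ 5)⁻¹ *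
          ∫⁻ z in parabolicCylinder r₀ z₀, ‖f z.1 z.2‖ₑ ^ q
        ≤ ENNReal.ofReal ((r₀ ^ 2 * r₀) ^ q) * ENNReal.ofReal (r₀ ^ 5)⁻¹ *
            ENNReal.ofReal (l ^ (2 * q) * r₀ ^ (5 - 3 * q)) := by
          gcongr
      _ = ENNReal.ofReal (l ^ (2 * q)) := by
          rw [← ENNReal.ofReal_mul (by positivity), ← ENNReal.ofReal_mul (by positivity)]
          congr 1
          have e1 : (r₀ ^ 2 * r₀) ^ q = r₀ ^ (3 * q) := by
            rw [show r₀ ^ 2 * r₀ = r₀ ^ (3 : ℕ) by ring, ← Real.rpow_natCast r₀ 3, ← Real.rpow_mul hr₀.le]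
            norm_num
          have e2 : r₀ ^ (5 - 3 * q) = r₀ ^ (5 : ℕ) / r₀ ^ (3 * q) := by
            rw [Real.rpow_sub hr₀, Real.rpow_ofNat]
          have e3 : 0 < r₀ ^ (3 * q) := Real.rpow_pos_of_pos hr₀ _
          rw [e1, e2]
          field_simp
  have key := H _ _ _ _ _ hS' hdivf' l h1 hl hlε h2 h3
  rw [← hpre2] at key
  have key' := ae_restrict_of_ae_restrict_preimage_stAffine hβ0 hr₀ z₀.1 z₀.2
    (S := parabolicCylinder (r₀ / 2) z₀) (P := fun z => ‖r₀ • u z.1 z.2‖ ≤ C₀ * l) key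
  filter_upwards [key'] with z hz
  rw [norm_smul, Real.norm_eq_abs, abs_of_pos hr₀] at hz
  rw [le_div_iff₀ hr₀]
  linarith

/-- **The unforced case of Lemarié-Rieusset's Thm. 14.4 from the local pressure estimate**:
for `f = 0` (trivially solenoidal) the named fact `lemarieRieusset_epsilon_regularity`'s
conclusion holds, given `RRS2016.lemma15_12`; stated through the accepted structured form
(`lemarieRieusset_epsilon_regularity_iff`). [cite: LemarieRieusset2016, Thm. 14.4 p. 505, case f = 0] -/
theorem lemarieRieusset_epsilon_regularity_zeroForce_of_lemma15_12 (h12 : RRS2016.lemma15_12)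
    {ν q : ℝ} (hν : 0 < ν) (hq : 5 / 2 < q) :
    ∃ ε₀ C₀ : ℝ, 0 < ε₀ ∧ 0 < C₀ ∧
      ∀ (Ω : Opens (ℝ × ℝ³)) (u : ℝ → ℝ³ → ℝ³) (p : ℝ → ℝ³ → ℝ) (G : ℝ → ℝ³ → ℝ³ →L[ℝ] ℝ³),
        IsLRSuitableWeakSolutionOn Ω ν q 0 u p G →
        ∀ (z₀ : ℝ × ℝ³) (r₀ l : ℝ), 0 < r₀ → parabolicCylinder r₀ z₀ ⊆ (Ω : Set (ℝ × ℝ³)) →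
          0 ≤ l → l ≤ ε₀ →
          ∫⁻ w in parabolicCylinder r₀ z₀,
              (‖u w.1 w.2‖ₑ ^ (3 : ℕ) + ‖p w.1 w.2‖ₑ ^ (3 / 2 : ℝ)) ≤ ENNReal.ofReal (l ^ 3 * r₀ ^ 2) →
          ∀ᵐ w ∂(volume.restrict (parabolicCylinder (r₀ / 2) z₀)), ‖u w.1 w.2‖ ≤ C₀ * l / r₀ := by
  obtain ⟨ε₀, C₀, hε₀, hC₀, H⟩ := lemarieRieusset_epsilon_regularity_divFree_of_lemma15_12 h12 ν q hν hq
  refine ⟨ε₀, C₀, hε₀, hC₀, fun Ω u p G hS z₀ r₀ l hr₀ hsub hl hlε hUP => ?_⟩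
  have hq0 : 0 < q := by linarith
  refine H Ω 0 u p G hS (fun φ _ => by simp) z₀ r₀ l hr₀ hsub hl hlε hUP ?_
  have e : (fun w : ℝ × ℝ³ => ‖(0 : ℝ → ℝ³ → ℝ³) w.1 w.2‖ₑ ^ q) = fun _ => 0 := by
    funext w
    simp [ENNReal.zero_rpow_of_pos hq0]
  rw [e, lintegral_zero]
  exact zero_le

end Literature.Analysis.FluidPDE
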